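import Literature.NumberTheory.NumberFields.RayClassFieldTwoVariableLiftable
import Literature.NumberTheory.NumberFields.RayClassFieldLocalTowerCharacter
import Literature.NumberTheory.NumberFields.RayClassFieldAdicCharacterPrincipal
import Literature.NumberTheory.NumberFields.RayClassFieldAdicCharacterLocalUnits
import Literature.NumberTheory.NumberFields.RayClassFieldSplitPrimePowerDegreeQuadratic
import Literature.NumberTheory.NumberFields.AlgebraNormCongruence
import Literature.NumberTheory.NumberFields.AmbiguousClassQuadratic
import Literature.NumberTheory.GaloisRepresentations.LubinTateColemanCoinvariantGaloisScalarTwo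
import HarnessLib

/-!
# Brick (c) at `p = 2`: DE SHALIT'S AUXILIARY INDICES `𝔞₁ = (α₁)`, `𝔞₂ = (r)` BY THE PRINCIPAL ROAD — the witnesses of the residual
# binders `a₁ a₂ γ w hγ hv₁ hn₁π hne hn₂ hv₂ hv₂'` of the (c)-capstone T15-split, for EVERY imaginary quadratic `K` with `2 = vv̄` split

Cell `bsd-print-cf2`, width seat `bsd-line-cf2c-w7` g31, route C `PrintCf2RubinValueTwo`, crux of record stmt-BirchSwinnertonDyer-24033
`TwoVariableMainConjAtSplitTwoQuad` (23720 nominal), BRICK §4(c), memo v12 (M1); `--supports` the crux as a helper.  THEOREMS ONLY (0 sorry,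
no named fact, no definition); Theses-free.  BSD is not proved by any of this.

The (c)-capstone `…ColemanCoinvariantCharTraceEllipticUnitsFrameDischargedSplit.exists_frame_…_of_split` (T15-split) still displays de Shalit's
two auxiliary indices of II §4.12 (29)–(33) as binders: liftable ideals `a₁ a₂` with `χ_π(σ̃_{a₁}) = γ = 1 + π²w` (`w` a unit), `π² ∣ N a₁ − 1`,
`N a₁ ≠ γ²`, `N a₂ = χ_π(σ̃_{a₂})²`, `χ_π(σ̃_{a₂}) ≠ ±1` (the rational-index road of `PAdicTwoVariableColemanImageCocycleOfUnitsGaloisKernel`).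
THIS file constructs them, with NO class-number hypothesis, from the split prime `2 = vv̄` alone:

* §1 (global) `exists_mem_mul_pow_sub_one_mem` (CRT: `β ∈ 𝔤v̄^6`, `β ≡ 1 (v)`), `four_dvd_absNorm_span_singleton_sub_one` (`4 ∣ N(1 + 4β) − 1`,
  norms of a totally complex field are positive), ★ `pow_four_dvd_of_natCast_mem_pow_eight` (`(n) ∈ v̄⁸ ⟹ 2⁴ ∣ n`,
  by `N(v̄) = 2` — no conjugation);
* §2 (local, any `F` with `#𝓀 = 2`, `2 = π·t`) ★ `not_pow_four_dvd_sq_sub_one` — `v_π(γ² − 1) = 3` EXACTLY for `γ = 1 + π²w`, `w` a unit;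
* §3 ★★★ `exists_principal_witnesses` — on the two-variable tower of `RayClassFieldTwoVariableDecomposition` (modulus `𝔤`, auxiliary prime `v̄`,
  ANY local lifts `σ̃_𝔞` of the Artin symbols with `hσ`): `α₁ := 1 + 4β`, `r := 1 + N(𝔤v̄)`, both `≡ 1 mod 𝔤v̄` hence LIFTABLE
  (`isLocArtinLiftable_span_singleton`), `γ := χ_π(σ̃_{(α₁)}) = α₁` and `χ_π(σ̃_{(r)}) = r` in `K_v` (`coe_lubinTateChar_eq_of_forall_eq_artinSymbol_span_singleton₂`),
  `w := t²·β_v`, and the five numeric side conditions — i.e. EXACTLY the residual (A)-binders of T15-split, as an `∃`.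

## References
* [deShalit1987] E. de Shalit, *Iwasawa theory of elliptic curves with complex multiplication* (1987), II §1.10 (p. 39), II §4.12 (29)–(33)
  (p. 66–68), II §4.14 (p. 71), II §4.17 (p. 78).
* [NeukirchANT1999] J. Neukirch, *Algebraic Number Theory* (1999), Ch. I §2 (norm as determinant), §8 Prop. (8.3); Ch. VI §7 Thm. (7.1).
* [Serre1973CourseArithmetic] J.-P. Serre, *A Course in Arithmetic* (1973), Ch. II §3.2 Thm. 3, §3.3.
-/

noncomputable section

set_option linter.dupNamespace false
set_option autoImplicit false

open scoped NumberField Classical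

namespace Summit.BirchSwinnertonDyer.BirchSwinnertonDyer.Theorems.PrintCf2.ColemanCoinvariantTraceEllipticUnitsResidualWitnesses

open Field IsDedekindDomain IsDedekindDomain.HeightOneSpectrum ValuativeRel NumberField
open Literature.NumberTheory.NumberFields
open Literature.NumberTheory.GaloisRepresentations Literature.NumberTheory.GaloisRepresentations.IsNonarchimedeanLocalField
  Literature.NumberTheory.GaloisRepresentations.LubinTate Literature.NumberTheory.GaloisRepresentations.ArtinLocalGlobal
open Literature.NumberTheory.LFunctions.AbelianDensity (artinSymbol)

/-! ## §1. Global: the congruence data of `α₁ = 1 + 4β` and `r` -/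

section Global

variable {K : Type} [Field K] [NumberField K] {v v' : HeightOneSpectrum (𝓞 K)}

/-- A prime not containing `𝔪` is coprime to it. [folklore] -/
private theorem isCoprime_of_not_le₃₃ {𝔪 : Ideal (𝓞 K)} (h : ¬ 𝔪 ≤ v.asIdeal) : IsCoprime 𝔪 v.asIdeal := by
  rw [Ideal.isCoprime_iff_sup_eq]
  exact v.isMaximal.out.2 _ (lt_of_le_of_ne le_sup_right fun e ↦ h (e ▸ le_sup_left))

/-- **CRT**: for `v ∤ 𝔤`, `v' ≠ v` there is `β ∈ 𝔤·v'^n` with `β ≡ 1 (mod v)`. [cite: NeukirchANT1999, Ch. I §3 Thm. (3.6)] -/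
theorem exists_mem_mul_pow_sub_one_mem {𝔤 : Ideal (𝓞 K)} (hv : ¬ 𝔤 ≤ v.asIdeal) (hvv' : v' ≠ v) (n : ℕ) :
    ∃ β : 𝓞 K, β ∈ 𝔤 * v'.asIdeal ^ n ∧ β - 1 ∈ v.asIdeal := by
  have hv'v : ¬ v'.asIdeal ≤ v.asIdeal := fun h ↦ hvv' (HeightOneSpectrum.ext (v'.isMaximal.eq_of_le v.isPrime.ne_top h))
  have hcop : IsCoprime (𝔤 * v'.asIdeal ^ n) v.asIdeal := (isCoprime_of_not_le₃₃ hv).mul_left (isCoprime_of_not_le₃₃ hv'v).pow_left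
  obtain ⟨β, hβ, j, hj, hβj⟩ := Ideal.isCoprime_iff_exists.mp hcop
  refine ⟨β, hβ, ?_⟩
  have e : β - 1 = -j := by rw [← hβj]; ring
  rw [e]
  exact neg_mem hj

/-- **`4 ∣ N((1 + 4β)) − 1`** for `1 + 4β ≠ 0` (`N(1 + 4β) ≡ 1 (mod 4)` as a determinant, and norms of a totally complex field are positive,
so `N((x)) = N(x)`). [cite: NeukirchANT1999, Ch. I §2] -/
theorem four_dvd_absNorm_span_singleton_sub_one [IsTotallyComplex K] (β : 𝓞 K) (h0 : (1 + 4 * β : 𝓞 K) ≠ 0) :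
    (4 : ℤ) ∣ ((Ideal.absNorm (Ideal.span {1 + 4 * β}) : ℕ) : ℤ) - 1 := by
  have hx : ((4 : ℤ) : 𝓞 K) ∣ (1 + 4 * β) - 1 := ⟨β, by push_cast; ring⟩
  have hpos : 0 ≤ Algebra.norm ℤ (1 + 4 * β : 𝓞 K) := by
    have hq := Literature.NumberTheory.NumberFields.AmbiguousClass.norm_pos_of_isTotallyComplex (L := K)
      (x := ((1 + 4 * β : 𝓞 K) : K)) (fun h ↦ h0 (by exact_mod_cast h))
    rw [← Algebra.coe_norm_int] at hq
    exact_mod_cast hq.le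
  exact intCast_dvd_absNorm_span_singleton_sub_one 4 hx hpos

/-- ★ **`(n) ∈ v̄⁸ ⟹ 2⁴ ∣ n`** at a split prime `2 = vv̄` of a quadratic field: `N(v̄⁸) = 2⁸ ∣ N((n)) = n²`. (No conjugation is used.)
[cite: NeukirchANT1999, Ch. I §8 Prop. (8.3)] -/
theorem pow_four_dvd_of_natCast_mem_pow_eight (hK2 : Module.finrank ℚ K = 2) (h2v : ((2 : ℕ) : 𝓞 K) ∈ v.asIdeal)
    (h2v' : ((2 : ℕ) : 𝓞 K) ∈ v'.asIdeal) (hvv' : v' ≠ v) {n : ℕ} (hn : (n : 𝓞 K) ∈ v'.asIdeal ^ 8) : 2 ^ 4 ∣ n := by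
  have hle : Ideal.span {(n : 𝓞 K)} ≤ v'.asIdeal ^ 8 := by rw [Ideal.span_singleton_le_iff_mem]; exact hn
  have hdvd := Ideal.absNorm_dvd_absNorm_of_le hle
  rw [map_pow, absNorm_eq_of_mem_of_mem_of_ne hK2 Nat.prime_two h2v' h2v hvv'.symm,
    Literature.NumberTheory.LFunctions.IdealNormCount.absNorm_span_natCast K n, hK2,
    show (2 : ℕ) ^ 8 = (2 ^ 4) ^ 2 by norm_num] at hdvd
  exact (Nat.pow_dvd_pow_iff two_ne_zero).mp hdvd

omit [NumberField K] in
/-- `4 ∈ v̄²` and `4β ∈ v̄⁸` for `β ∈ 𝔤v̄⁶`. [folklore] -/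
theorem four_mul_mem_pow_eight {𝔤 : Ideal (𝓞 K)} (h2v' : ((2 : ℕ) : 𝓞 K) ∈ v'.asIdeal) {β : 𝓞 K} (hβ : β ∈ 𝔤 * v'.asIdeal ^ 6) :
    4 * β ∈ v'.asIdeal ^ 8 := by
  have h4 : (4 : 𝓞 K) ∈ v'.asIdeal ^ 2 := by
    rw [show (4 : 𝓞 K) = ((2 : ℕ) : 𝓞 K) * ((2 : ℕ) : 𝓞 K) by push_cast; norm_num, pow_two]
    exact Ideal.mul_mem_mul h2v' h2v'
  rw [show (8 : ℕ) = 2 + 6 by norm_num, pow_add]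
  exact Ideal.mul_mem_mul h4 (Ideal.mul_le_left hβ)

omit [NumberField K] in
/-- `1 + x ∉ v` for `x ∈ v`. [folklore] -/
theorem one_add_not_mem {x : 𝓞 K} (hx : x ∈ v.asIdeal) : 1 + x ∉ v.asIdeal := fun h ↦
  v.isPrime.ne_top ((Ideal.eq_top_iff_one _).mpr (by simpa using Ideal.sub_mem _ h hx))

end Global

/-! ## §2. Local: `v_π(γ² − 1) = 3` exactly for `γ = 1 + π²w` -/

section Local

variable {F : Type} [Field F] [ValuativeRel F] [TopologicalSpace F] [IsNonarchimedeanLocalField F]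

/-- `π ∈ 𝔪`. [folklore] -/
private theorem uniformizer_mem_maximalIdeal {π : 𝒪[F]} (hπ : (valuation F).IsUniformizer (π : F)) : π ∈ IsLocalRing.maximalIdeal 𝒪[F] :=
  (uniformizer_dvd_iff_mem_maximalIdeal hπ).mp (dvd_refl π)

/-- A unit plus an element of `𝔪` is a unit. [folklore] -/
private theorem isUnit_add_of_mem_maximalIdeal {t x : 𝒪[F]} (ht : IsUnit t) (hx : x ∈ IsLocalRing.maximalIdeal 𝒪[F]) : IsUnit (t + x) := by
  by_contra h
  have h1 : t + x ∈ IsLocalRing.maximalIdeal 𝒪[F] := (IsLocalRing.mem_maximalIdeal _).mpr h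
  have h2 : t ∈ IsLocalRing.maximalIdeal 𝒪[F] := by simpa using Ideal.sub_mem _ h1 hx
  exact (IsLocalRing.mem_maximalIdeal _).mp h2 ht

/-- ★ **`γ² − 1 = π³·U` with `U` a unit**, for `γ = 1 + π²w` (`w` a unit) when `2 = π·t` (`t` a unit): `γ² − 1 = π²w(2 + π²w) = π³·w(t + πw)`.
So `v_π(γ² − 1) = 3` EXACTLY and **`π⁴ ∤ γ² − 1`**. [cite: Serre1973CourseArithmetic, Ch. II §3.3] -/
theorem not_pow_four_dvd_sq_sub_one {π : 𝒪[F]} (hπ : (valuation F).IsUniformizer (π : F)) {t : 𝒪[F]ˣ} (h2 : (2 : 𝒪[F]) = π * t)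
    (γ w : 𝒪[F]ˣ) (hγ : (γ : 𝒪[F]) = 1 + π ^ 2 * w) : ¬ π ^ 4 ∣ (γ : 𝒪[F]) ^ 2 - 1 := by
  have hπ0 : (π : 𝒪[F]) ≠ 0 := by
    intro h
    have h1 := hπ.ne_zero
    rw [h] at h1
    exact h1 rfl
  have hU : IsUnit ((w : 𝒪[F]) * (t + π * w)) :=
    (Units.isUnit w).mul (isUnit_add_of_mem_maximalIdeal (Units.isUnit t) (Ideal.mul_mem_right _ _ (uniformizer_mem_maximalIdeal hπ)))
  have e : (γ : 𝒪[F]) ^ 2 - 1 = π ^ 3 * ((w : 𝒪[F]) * (t + π * w)) := by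
    rw [hγ]
    linear_combination (π ^ 2 * (w : 𝒪[F])) * h2
  rintro ⟨k, hk⟩
  rw [e, show π ^ 4 * k = π ^ 3 * (π * k) by ring] at hk
  have hk' := mul_left_cancel₀ (pow_ne_zero 3 hπ0) hk
  have hmem : (w : 𝒪[F]) * (t + π * w) ∈ IsLocalRing.maximalIdeal 𝒪[F] := by
    rw [hk']
    exact Ideal.mul_mem_right _ _ (uniformizer_mem_maximalIdeal hπ)
  exact (IsLocalRing.mem_maximalIdeal _).mp hmem hU

omit [TopologicalSpace F] [IsNonarchimedeanLocalField F] in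
/-- `16 = π⁴·t⁴` when `2 = π·t`; hence `16 ∣ n − 1 ⟹ π⁴ ∣ n − 1` in `𝒪_F`. [folklore] -/
theorem pow_four_dvd_natCast_sub_one {π : 𝒪[F]} {t : 𝒪[F]ˣ} (h2 : (2 : 𝒪[F]) = π * t) {n : ℕ} (h : 2 ^ 4 ∣ n - 1) (hn : 1 ≤ n) :
    π ^ 4 ∣ (n : 𝒪[F]) - 1 := by
  obtain ⟨k, hk⟩ := h
  have e : (n : 𝒪[F]) - 1 = ((n - 1 : ℕ) : 𝒪[F]) := by push_cast [Nat.cast_sub hn]; ring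
  refine ⟨(t : 𝒪[F]) ^ 4 * k, ?_⟩
  rw [e, hk]
  push_cast
  linear_combination ((k : 𝒪[F]) * (2 + π * t) * (4 + (π * t) ^ 2)) * h2

omit [TopologicalSpace F] [IsNonarchimedeanLocalField F] in
/-- `4 = π²·t²` when `2 = π·t`; hence `4 ∣ n − 1 ⟹ π² ∣ n − 1` in `𝒪_F`. [folklore] -/
theorem sq_dvd_natCast_sub_one {π : 𝒪[F]} {t : 𝒪[F]ˣ} (h2 : (2 : 𝒪[F]) = π * t) {n : ℕ} (h : (4 : ℤ) ∣ ((n : ℕ) : ℤ) - 1) :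
    π ^ 2 ∣ (n : 𝒪[F]) - 1 := by
  obtain ⟨k, hk⟩ := h
  have e : (n : 𝒪[F]) - 1 = (((n : ℤ) - 1 : ℤ) : 𝒪[F]) := by push_cast; ring
  refine ⟨(t : 𝒪[F]) ^ 2 * k, ?_⟩
  rw [e, hk]
  push_cast
  linear_combination ((k : 𝒪[F]) * (2 + π * t)) * h2

end Local

/-! ## §3. The witnesses on the two-variable tower -/

section Witnesses

variable {K : Type} [Field K] [NumberField K] [IsTotallyComplex K] {𝔤 : Ideal (𝓞 K)} {v v' : HeightOneSpectrum (𝓞 K)}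

set_option maxHeartbeats 800000 in
/-- ★★★ **DE SHALIT'S AUXILIARY INDICES BY THE PRINCIPAL ROAD.**  On the two-variable tower of `RayClassFieldTwoVariableDecomposition`
(`K` imaginary quadratic, modulus `𝔤`, `v ∤ 𝔤`, auxiliary prime `v̄ ≠ v` with `2 ∈ v`, `2 ∈ v̄`, `w_{𝔤v̄} = 1`, absolute models `α_i = π^{f_i}`,
unramified base `E_j` with offset `c` and the (DEG)/(INERT)/(COUNT) data, `2 = π·t` in `𝒪_v`) and for ANY local lifts `σ̃_𝔞` of the Artin
symbols of the liftable ideals (`hσ`), there are `α₁ := 1 + 4β ∈ 𝓞_K` (`β ∈ 𝔤v̄⁶`, `β ≡ 1 (v)`) and `r := 1 + N(𝔤v̄) ∈ ℕ` with `(α₁)`, `(r)`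
LIFTABLE, `γ := χ_π(σ̃_{(α₁)}) = α₁ = 1 + π²w` (`w = t²β_v` a unit), `π² ∣ N(α₁) − 1`, `N(α₁) ≠ γ²` (valuations: `v_π(γ² − 1) = 3`, whereas
`N(α₁) = α₁²` would put `N(α₁) − 1 ∈ v̄⁸`, so `2⁴ ∣ N(α₁) − 1`), `N(r) = r² = χ_π(σ̃_{(r)})²`, `χ_π(σ̃_{(r)}) = r ≠ ±1` — the residual
(A)-binders `a₁ a₂ γ w hγ hv₁ hn₁π hne hn₂ hv₂ hv₂'` (`m = 2`) of the (c)-capstone T15-split, for every imaginary quadratic `K` in which `2`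
splits (no class-number hypothesis). [cite: deShalit1987, II §1.10 (p. 39), II §4.12 (29)–(33) (p. 66–68), II §4.17 (p. 78)]
[cite: NeukirchANT1999, Ch. I §2, §8 Prop. (8.3); Ch. VI §7 Thm. (7.1)] [cite: Serre1973CourseArithmetic, Ch. II §3.3] -/
theorem exists_principal_witnesses (hK2 : Module.finrank ℚ K = 2)
    (h𝔤0 : 𝔤 ≠ ⊥) (hv : ¬ 𝔤 ≤ v.asIdeal) (hvv' : v' ≠ v) (hw : ∀ u : (𝓞 K)ˣ, (u : 𝓞 K) - 1 ∈ 𝔤 * v'.asIdeal → u = 1)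
    (h2v : ((2 : ℕ) : 𝓞 K) ∈ v.asIdeal) (h2v' : ((2 : ℕ) : 𝓞 K) ∈ v'.asIdeal)
    {π : 𝒪[v.adicCompletion K]} (hπ : (valuation (v.adicCompletion K)).IsUniformizer (π : v.adicCompletion K))
    {t : 𝒪[v.adicCompletion K]ˣ} (h2 : (2 : 𝒪[v.adicCompletion K]) = π * t)
    {αt : ℕ → 𝓞 K} (hα0 : ∀ i, αt i ≠ 0) (hα𝔪 : ∀ i, αt i - 1 ∈ 𝔤 * v'.asIdeal ^ (i + 1))
    (hαw : ∀ i, ∀ w : HeightOneSpectrum (𝓞 K), w ≠ v → αt i ∉ w.asIdeal)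
    {ft : ℕ → ℕ} (hαπ : ∀ i, ((αt i : K) : v.adicCompletion K) = (π : v.adicCompletion K) ^ ft i)
    (E : ℕ → IntermediateField (v.adicCompletion K) (AlgebraicClosure (v.adicCompletion K)))
    [∀ j, FiniteDimensional (v.adicCompletion K) (E j)] [∀ j, IsGalois (v.adicCompletion K) (E j)]
    (hmono : Monotone E) (hE : ∀ j, E j ≤ maxUnramified (v.adicCompletion K)) (c : ℕ)
    (hdegE : ∀ i, ∀ w : WeilGroup (v.adicCompletion K),
      WeilGroup.toAbsGalois (v.adicCompletion K) w ∈ (E (i + c)).fixingSubgroup → (ft i : ℤ) ∣ WeilGroup.deg w)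
    (hinert : ∀ i, ∀ τ : absoluteGaloisGroup (v.adicCompletion K),
      (∀ y ∈ rayClassField K (𝔤 * v'.asIdeal ^ (i + 1)),
        τ • absClosureEmbedding K (v.adicCompletion K) y = absClosureEmbedding K (v.adicCompletion K) y) →
        τ ∈ (E (i + c)).fixingSubgroup)
    (hcount : ∀ i k : ℕ, IntermediateField.relfinrank (rayClassField K (𝔤 * v'.asIdeal ^ (i + 1) * v.asIdeal ^ (k + 1)))
        (rayClassField K (𝔤 * v'.asIdeal ^ (i + 1 + 1) * v.asIdeal ^ (k + 1))) * Module.finrank (v.adicCompletion K) (E (i + c)) ≤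
        Module.finrank (v.adicCompletion K) (E (i + 1 + c)))
    (σ : {𝔞 : Ideal (𝓞 K) // IsLocArtinLiftable 𝔤 v v' 𝔞} → absoluteGaloisGroup (v.adicCompletion K))
    (hσ : ∀ a, ∀ i k : ℕ, absRestrictNormalHom (rayClassField K (𝔤 * v'.asIdeal ^ (i + 1) * v.asIdeal ^ (k + 1)))
        (absGaloisRestrict K (v.adicCompletion K) (σ a)) =
      artinSymbol (galFrob K (rayClassField K (𝔤 * v'.asIdeal ^ (i + 1) * v.asIdeal ^ (k + 1)))) (a.1 : Ideal (𝓞 K))) :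
    ∃ (α₁ : 𝓞 K) (r : ℕ) (h₁ : IsLocArtinLiftable 𝔤 v v' (Ideal.span {α₁})) (h₂ : IsLocArtinLiftable 𝔤 v v' (Ideal.span {(r : 𝓞 K)}))
      (γ w : 𝒪[v.adicCompletion K]ˣ),
      α₁ - 1 ∈ 𝔤 * v'.asIdeal ∧ (r : 𝓞 K) - 1 ∈ 𝔤 * v'.asIdeal ∧
      (γ : 𝒪[v.adicCompletion K]) = 1 + π ^ 2 * w ∧
      ((γ : 𝒪[v.adicCompletion K]) : v.adicCompletion K) = ((α₁ : K) : v.adicCompletion K) ∧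
      lubinTateChar hπ (σ ⟨Ideal.span {α₁}, h₁⟩) = γ ∧
      π ^ 2 ∣ ((Ideal.absNorm (Ideal.span {α₁}) : ℕ) : 𝒪[v.adicCompletion K]) - 1 ∧
      ((Ideal.absNorm (Ideal.span {α₁}) : ℕ) : 𝒪[v.adicCompletion K]) ≠ (γ : 𝒪[v.adicCompletion K]) ^ 2 ∧
      ((Ideal.absNorm (Ideal.span {(r : 𝓞 K)}) : ℕ) : 𝒪[v.adicCompletion K]) =
        (lubinTateChar hπ (σ ⟨Ideal.span {(r : 𝓞 K)}, h₂⟩) : 𝒪[v.adicCompletion K]) ^ 2 ∧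
      lubinTateChar hπ (σ ⟨Ideal.span {(r : 𝓞 K)}, h₂⟩) ≠ 1 ∧ lubinTateChar hπ (σ ⟨Ideal.span {(r : 𝓞 K)}, h₂⟩) ≠ -1 := by
  -- ### `β ∈ 𝔤v̄⁶`, `β ≡ 1 (v)`; `α₁ := 1 + 4β`
  obtain ⟨β, hβ, hβ1⟩ := exists_mem_mul_pow_sub_one_mem (v := v) (v' := v') (𝔤 := 𝔤) hv hvv' 6
  have hβv : β ∉ v.asIdeal := fun h ↦
    v.isPrime.ne_top ((Ideal.eq_top_iff_one _).mpr (by simpa using Ideal.sub_mem _ h hβ1))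
  have h4β8 : 4 * β ∈ v'.asIdeal ^ 8 := four_mul_mem_pow_eight h2v' hβ
  have hα₁𝔪 : (1 + 4 * β : 𝓞 K) - 1 ∈ 𝔤 * v'.asIdeal := by
    rw [add_sub_cancel_left]
    exact Ideal.mul_mem_left _ _ (Ideal.mul_mono_right (Ideal.pow_le_self (by norm_num)) hβ)
  have h4v : (4 : 𝓞 K) * β ∈ v.asIdeal := by
    refine Ideal.mul_mem_right _ _ ?_
    rw [show (4 : 𝓞 K) = ((2 : ℕ) : 𝓞 K) * ((2 : ℕ) : 𝓞 K) by push_cast; norm_num]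
    exact Ideal.mul_mem_left _ _ h2v
  have hα₁v : (1 + 4 * β : 𝓞 K) ∉ v.asIdeal := one_add_not_mem h4v
  have hα₁0 : (1 + 4 * β : 𝓞 K) ≠ 0 := fun h ↦ hα₁v (by rw [h]; exact Submodule.zero_mem _)
  have h₁ : IsLocArtinLiftable 𝔤 v v' (Ideal.span {1 + 4 * β}) :=
    isLocArtinLiftable_span_singleton h𝔤0 hv hvv' hw hπ hα0 hα𝔪 hαw hαπ E hmono hE c hdegE hinert hcount hα₁0 hα₁𝔪 hα₁v
  -- ### `r := 1 + N(𝔤v̄)`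
  have h2N : Ideal.absNorm v'.asIdeal = 2 := absNorm_eq_of_mem_of_mem_of_ne hK2 Nat.prime_two h2v' h2v hvv'.symm
  have hNmem : ((Ideal.absNorm (𝔤 * v'.asIdeal) : ℕ) : 𝓞 K) ∈ 𝔤 * v'.asIdeal := Ideal.absNorm_mem _
  have hN0 : Ideal.absNorm (𝔤 * v'.asIdeal) ≠ 0 := by
    rw [Ne, Ideal.absNorm_eq_zero_iff]
    exact mul_ne_zero h𝔤0 v'.ne_bot
  have hr𝔪 : (((1 + Ideal.absNorm (𝔤 * v'.asIdeal) : ℕ) : 𝓞 K)) - 1 ∈ 𝔤 * v'.asIdeal := by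
    push_cast
    rw [add_sub_cancel_left]
    exact hNmem
  have hNv : ((Ideal.absNorm (𝔤 * v'.asIdeal) : ℕ) : 𝓞 K) ∈ v.asIdeal := by
    rw [map_mul, h2N]
    push_cast
    exact Ideal.mul_mem_left _ _ h2v
  have hrv : ((1 + Ideal.absNorm (𝔤 * v'.asIdeal) : ℕ) : 𝓞 K) ∉ v.asIdeal := by
    push_cast
    exact one_add_not_mem hNv
  have hr0 : ((1 + Ideal.absNorm (𝔤 * v'.asIdeal) : ℕ) : 𝓞 K) ≠ 0 := fun h ↦ hrv (by rw [h]; exact Submodule.zero_mem _)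
  have h₂ : IsLocArtinLiftable 𝔤 v v' (Ideal.span {((1 + Ideal.absNorm (𝔤 * v'.asIdeal) : ℕ) : 𝓞 K)}) :=
    isLocArtinLiftable_span_singleton h𝔤0 hv hvv' hw hπ hα0 hα𝔪 hαw hαπ E hmono hE c hdegE hinert hcount hr0 hr𝔪 hrv
  -- ### the local units `γ = (α₁)_v`, `β_v`, `w = t²β_v`
  haveI : CharZero (v.adicCompletion K) := charZero_of_injective_algebraMap (algebraMap K (v.adicCompletion K)).injective
  let γ : 𝒪[v.adicCompletion K]ˣ :=
    Units.map (integerEquivAdicCompletionIntegers v).symm.toRingHom.toMonoidHom (integerUnit v (1 + 4 * β) hα₁v)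
  let βv : 𝒪[v.adicCompletion K]ˣ :=
    Units.map (integerEquivAdicCompletionIntegers v).symm.toRingHom.toMonoidHom (integerUnit v β hβv)
  have hγK : ((γ : 𝒪[v.adicCompletion K]) : v.adicCompletion K) = (((1 + 4 * β : 𝓞 K) : K) : v.adicCompletion K) := rfl
  have hβK : ((βv : 𝒪[v.adicCompletion K]) : v.adicCompletion K) = ((β : K) : v.adicCompletion K) := rfl
  have hγψ : ((γ : 𝒪[v.adicCompletion K]) : v.adicCompletion K) = 1 + 4 * algebraMap K (v.adicCompletion K) (β : K) := by
    rw [hγK, ← algebraMap_adicCompletion_apply]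
    push_cast
    simp only [map_ofNat]
  have hβψ : ((βv : 𝒪[v.adicCompletion K]) : v.adicCompletion K) = algebraMap K (v.adicCompletion K) (β : K) := by
    rw [hβK, ← algebraMap_adicCompletion_apply]
  have h2F : (2 : v.adicCompletion K) = (π : v.adicCompletion K) * ((t : 𝒪[v.adicCompletion K]) : v.adicCompletion K) := by
    have h := congrArg (Subtype.val : 𝒪[v.adicCompletion K] → v.adicCompletion K) h2
    push_cast at h
    exact h
  have hγw : (γ : 𝒪[v.adicCompletion K]) = 1 + π ^ 2 * ((t ^ 2 * βv : 𝒪[v.adicCompletion K]ˣ) : 𝒪[v.adicCompletion K]) := by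
    apply Subtype.ext
    push_cast
    rw [hγψ, hβψ]
    linear_combination (algebraMap K (v.adicCompletion K) (β : K) *
      (2 + (π : v.adicCompletion K) * ((t : 𝒪[v.adicCompletion K]) : v.adicCompletion K))) * h2F
  -- ### the characters
  have hχ₁ : lubinTateChar hπ (σ ⟨Ideal.span {1 + 4 * β}, h₁⟩) = γ := by
    have h := coe_lubinTateChar_eq_of_forall_eq_artinSymbol_span_singleton₂ hπ h𝔤0 hv hvv' hw hα0 hα𝔪 hαw hαπ E c hdegE hinert hα₁0 hα₁𝔪
      hα₁v (σ := σ ⟨Ideal.span {1 + 4 * β}, h₁⟩) (fun k ↦ hσ ⟨Ideal.span {1 + 4 * β}, h₁⟩ 0 k)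
    exact Units.ext (Subtype.ext (h.trans hγK.symm))
  have hχ₂ : (((lubinTateChar hπ (σ ⟨Ideal.span {((1 + Ideal.absNorm (𝔤 * v'.asIdeal) : ℕ) : 𝓞 K)}, h₂⟩) :
      𝒪[v.adicCompletion K]ˣ) : 𝒪[v.adicCompletion K]) : v.adicCompletion K) = ((1 + Ideal.absNorm (𝔤 * v'.asIdeal) : ℕ) : v.adicCompletion K) := by
    have h := coe_lubinTateChar_eq_of_forall_eq_artinSymbol_span_singleton₂ hπ h𝔤0 hv hvv' hw hα0 hα𝔪 hαw hαπ E c hdegE hinert hr0 hr𝔪 hrv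
      (σ := σ ⟨_, h₂⟩) (fun k ↦ hσ ⟨_, h₂⟩ 0 k)
    rw [h, ← algebraMap_adicCompletion_apply, ← map_natCast (algebraMap K (v.adicCompletion K))]
    congr 1
  have hχ₂O : ((lubinTateChar hπ (σ ⟨Ideal.span {((1 + Ideal.absNorm (𝔤 * v'.asIdeal) : ℕ) : 𝓞 K)}, h₂⟩) : 𝒪[v.adicCompletion K]ˣ) :
      𝒪[v.adicCompletion K]) = ((1 + Ideal.absNorm (𝔤 * v'.asIdeal) : ℕ) : 𝒪[v.adicCompletion K]) := by
    apply Subtype.ext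
    rw [hχ₂]
    push_cast
    ring
  -- ### assembly
  refine ⟨1 + 4 * β, 1 + Ideal.absNorm (𝔤 * v'.asIdeal), h₁, h₂, γ, t ^ 2 * βv, hα₁𝔪, hr𝔪, hγw, hγK, hχ₁,
    sq_dvd_natCast_sub_one h2 (four_dvd_absNorm_span_singleton_sub_one β hα₁0), ?_, ?_, ?_, ?_⟩
  · -- `N(α₁) ≠ γ²`
    intro heq
    have hn1 : 1 ≤ Ideal.absNorm (Ideal.span {1 + 4 * β}) := by
      refine Nat.one_le_iff_ne_zero.mpr ?_
      rw [Ne, Ideal.absNorm_eq_zero_iff, Ideal.span_singleton_eq_bot]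
      exact hα₁0
    refine not_pow_four_dvd_sq_sub_one hπ h2 γ (t ^ 2 * βv) hγw ?_
    rw [← heq]
    refine pow_four_dvd_natCast_sub_one h2 (pow_four_dvd_of_natCast_mem_pow_eight (v := v) (v' := v') hK2 h2v h2v' hvv' ?_) hn1
    -- `N(α₁) = α₁²` in `𝓞_K` (injectivity of `𝓞_K → K → K_v`)
    have hsq : ((Ideal.absNorm (Ideal.span {1 + 4 * β}) : ℕ) : 𝓞 K) = (1 + 4 * β) ^ 2 := by
      apply RingOfIntegers.coe_injective
      apply (algebraMap K (v.adicCompletion K)).injective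
      have h : (((Ideal.absNorm (Ideal.span {1 + 4 * β}) : ℕ) : 𝒪[v.adicCompletion K]) : v.adicCompletion K) =
          ((((γ : 𝒪[v.adicCompletion K]) ^ 2 : 𝒪[v.adicCompletion K])) : v.adicCompletion K) := congrArg Subtype.val heq
      push_cast at h ⊢
      rw [hγψ] at h
      simp only [map_ofNat]
      exact h
    have e : ((Ideal.absNorm (Ideal.span {1 + 4 * β}) - 1 : ℕ) : 𝓞 K) = (4 * β) * (1 + 4 * β + 1) := by
      push_cast [Nat.cast_sub hn1]
      rw [hsq]
      ring
    rw [e]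
    exact Ideal.mul_mem_right _ _ h4β8
  · -- `N(r) = r² = χ²`
    rw [hχ₂O, Literature.NumberTheory.LFunctions.IdealNormCount.absNorm_span_natCast K, hK2]
    push_cast
    ring
  · -- `χ ≠ 1` (`r ≠ 1`)
    intro h1
    have h := hχ₂O
    rw [h1, Units.val_one] at h
    have h' : ((1 : 𝒪[v.adicCompletion K]) : v.adicCompletion K) = ((1 + Ideal.absNorm (𝔤 * v'.asIdeal) : ℕ) : v.adicCompletion K) := by
      rw [h]; push_cast; ring
    push_cast at h'
    have h'' : ((Ideal.absNorm (𝔤 * v'.asIdeal) : ℕ) : v.adicCompletion K) = 0 := by linear_combination -h'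
    exact hN0 (by exact_mod_cast h'')
  · -- `χ ≠ -1` (`r ≠ -1` in characteristic zero)
    intro h1
    have h := hχ₂O
    rw [h1, Units.val_neg, Units.val_one] at h
    have h' : ((-1 : 𝒪[v.adicCompletion K]) : v.adicCompletion K) = ((1 + Ideal.absNorm (𝔤 * v'.asIdeal) : ℕ) : v.adicCompletion K) := by
      rw [h]; push_cast; ring
    push_cast at h'
    have h'' : ((Ideal.absNorm (𝔤 * v'.asIdeal) + 2 : ℕ) : v.adicCompletion K) = 0 := by push_cast; linear_combination -h'
    exact Nat.succ_ne_zero (Ideal.absNorm (𝔤 * v'.asIdeal) + 1) (by exact_mod_cast h'')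

end Witnesses

end Summit.BirchSwinnertonDyer.BirchSwinnertonDyer.Theorems.PrintCf2.ColemanCoinvariantTraceEllipticUnitsResidualWitnesses

end
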